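import Mathlib
import Literature.NumberTheory.LFunctions.Zhang2022.AppendixAEulerFactorM2

/-!
# Zhang (2022) Appendix A, proof of Lemma 16.1 (vii): generic per-prime inequalities for u035–u037

Topic `Literature/NumberTheory/LFunctions/Zhang2022` (Landau–Siegel audit tree; verdict-neutral).
Y. Zhang, *Discrete mean estimates and the Landau–Siegel zero*, arXiv:2211.02515v1 (2022)
[Zhang2022LandauSiegel] — **an unrefereed manuscript under adjudication**; this file PROVES elementary
inequalities between explicit rational expressions in `v = χ(q)`, `w = q^{−β₁}`, `x = q^{−s}` (the closed
forms of `AppendixAEulerFactorM2`) and asserts nothing about the manuscript's theorems. Campaign D-0069,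
DAG nodes `Z22:§A.u035`–`Z22:§A.u037` [Z22 p. 105, tex L5206–L5216].

* `norm_locLam_sub_one_le` — `‖λ₂(q) − 1‖ ≤ 2B_w/q` (`‖w − 1‖ ≤ B_w`): "`λ̃₂(q,d) = 1 + O(α log q/q)`";
* `locPref_sub_inv_eq`, `norm_locPref_sub_inv_le` — **u037**: `‖locPref − (1−v/q)⁻¹‖ ≤ (38B_w + 20B_x)/q`;
* `norm_lam_mul_locTerm_le` — **u036**: `‖λ·c(w−1)x/(1−wx)‖ ≤ 20B_w/q`;
* `norm_lam_mul_locSer_add_le` — **u035**: `‖λS + v/(q−1)‖ ≤ (41B_w + 8B_x + 26B_λ)/q` where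
  `S = c(w−1)x/(1−wx) − (vq/(q−1))x(1−x)/(1−wx)` is the closed-form local series.
Numbers, not adjectives: the constants are crude.

## References
* Y. Zhang, arXiv:2211.02515v1 (2022), Appendix A p. 105. [cite: Zhang2022LandauSiegel, App. A p. 105]
-/

noncomputable section

open Complex Real

namespace Literature.NumberTheory.LFunctions.Zhang2022.AppendixA

/-! ## §2. Generic estimates in the variables `v = χ(q)`, `w = q^{−β₁}`, `x = q^{−s}` -/

section Generic

variable {v w x : ℂ} {q : ℕ}

/-- `‖λ₂(q) − 1‖ ≤ 2B/q` when `‖w − 1‖ ≤ B`: `λ₂(q) − 1 = χ(q)(1 − w)/(q − χ(q))`.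
[cite: Zhang2022LandauSiegel, App. A p. 105] -/
theorem norm_locLam_sub_one_le (hv : ‖v‖ ≤ 1) (hq : 2 ≤ q) {B : ℝ} (hw : ‖w - 1‖ ≤ B) :
    ‖locLam v w q - 1‖ ≤ 2 * B / q := by
  have hq' : (2 : ℝ) ≤ q := by exact_mod_cast hq
  have hq0 : (q : ℂ) ≠ 0 := by exact_mod_cast (show q ≠ 0 by omega)
  have hqv : (q : ℂ) - v ≠ 0 := by
    intro h
    have : ‖(q : ℂ)‖ = ‖v‖ := by rw [sub_eq_zero.mp h]
    rw [Complex.norm_natCast] at this; linarith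
  have e : locLam v w q - 1 = v * (1 - w) / ((q : ℂ) - v) := by
    have h1 : (1 : ℂ) - v / q ≠ 0 := by rw [one_sub_div hq0]; exact div_ne_zero hqv hq0
    unfold locLam
    field_simp
    ring
  rw [e, norm_div, norm_mul]
  have hden : (q : ℝ) / 2 ≤ ‖(q : ℂ) - v‖ := by
    have h := norm_sub_norm_le (q : ℂ) v
    rw [Complex.norm_natCast] at h; linarith
  have hB : 0 ≤ B := le_trans (norm_nonneg _) hw
  have hw' : ‖1 - w‖ ≤ B := by rwa [norm_sub_rev]
  calc ‖v‖ * ‖1 - w‖ / ‖(q : ℂ) - v‖ ≤ 1 * B / ((q : ℝ) / 2) := by gcongr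
    _ = 2 * B / q := by field_simp

/-- **The identity behind u037**: `locPref − (1 − v/q)⁻¹ =
[(1−w)x(1−v/q) + v(x−1/q)(1−x)] / ((1−x)(1−vx)(1−v/q))` (vanishes at `w = 1`, `x = 1/q`).
[cite: Zhang2022LandauSiegel, App. A p. 105] -/
theorem locPref_sub_inv_eq (hv : ‖v‖ ≤ 1) (hx : ‖x‖ ≤ 3 / 5) (hq : 2 ≤ q) :
    locPref v w x - (1 - v / q)⁻¹ =
      ((1 - w) * x * (1 - v / q) + v * (x - 1 / q) * (1 - x)) /
        ((1 - x) * (1 - v * x) * (1 - v / q)) := by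
  have hq' : (2 : ℝ) ≤ q := by exact_mod_cast hq
  have hq0 : (q : ℂ) ≠ 0 := by exact_mod_cast (show q ≠ 0 by omega)
  have n1 : ∀ {y : ℂ}, ‖y‖ ≤ 3 / 5 → 1 - y ≠ 0 := fun {y} hy h => by
    have : ‖y‖ = 1 := by rw [← sub_eq_zero.mp h, norm_one]
    linarith
  have h1 : 1 - x ≠ 0 := n1 hx
  have h2 : 1 - v * x ≠ 0 := n1 (by rw [norm_mul]; nlinarith [norm_nonneg v, norm_nonneg x])
  have h2' : 1 - x * v ≠ 0 := by rwa [mul_comm] at h2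
  have hqv : (q : ℂ) - v ≠ 0 := by
    intro h
    have : ‖(q : ℂ)‖ = ‖v‖ := by rw [sub_eq_zero.mp h]
    rw [Complex.norm_natCast] at this; linarith
  have h3 : (1 : ℂ) - v / q ≠ 0 := by rw [one_sub_div hq0]; exact div_ne_zero hqv hq0
  unfold locPref
  field_simp
  ring

/-- **u037-type estimate**: `‖locPref − (1−v/q)⁻¹‖ ≤ (38‖w−1‖ + 20‖1−qx‖)/q` for `‖v‖ ≤ 1`,
`‖x‖ ≤ 3/5`, `‖qx‖ ≤ 2`, `q ≥ 2` (any `w`). [cite: Zhang2022LandauSiegel, App. A p. 105] -/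
theorem norm_locPref_sub_inv_le (hv : ‖v‖ ≤ 1) (hx : ‖x‖ ≤ 3 / 5)
    (hqx : ‖(q : ℂ) * x‖ ≤ 2) (hq : 2 ≤ q) :
    ‖locPref v w x - (1 - v / q)⁻¹‖ ≤ (38 * ‖w - 1‖ + 20 * ‖1 - q * x‖) / q := by
  have hq' : (2 : ℝ) ≤ q := by exact_mod_cast hq
  have hq0 : (0 : ℝ) < q := by linarith
  have hqc : (q : ℂ) ≠ 0 := by exact_mod_cast (show q ≠ 0 by omega)
  rw [locPref_sub_inv_eq hv hx hq, norm_div]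
  -- denominator
  have e1 : 2 / 5 ≤ ‖1 - x‖ := by
    have := norm_sub_norm_le (1 : ℂ) x; rw [norm_one] at this; linarith
  have e2 : 2 / 5 ≤ ‖1 - v * x‖ := by
    have hvx : ‖v * x‖ ≤ 3 / 5 := by rw [norm_mul]; nlinarith [norm_nonneg v, norm_nonneg x]
    have := norm_sub_norm_le (1 : ℂ) (v * x); rw [norm_one] at this; linarith
  have e3 : 1 / 2 ≤ ‖(1 : ℂ) - v / q‖ := by
    have hvq : ‖v / (q : ℂ)‖ ≤ 1 / 2 := by
      rw [norm_div, Complex.norm_natCast, div_le_iff₀ hq0]; linarith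
    have := norm_sub_norm_le (1 : ℂ) (v / q); rw [norm_one] at this; linarith
  have hD : 2 / 25 ≤ ‖(1 - x) * (1 - v * x) * (1 - v / (q : ℂ))‖ := by
    rw [norm_mul, norm_mul]
    calc (2 : ℝ) / 25 = 2 / 5 * (2 / 5) * (1 / 2) := by norm_num
      _ ≤ ‖1 - x‖ * ‖1 - v * x‖ * ‖(1 : ℂ) - v / q‖ := by gcongr
  have hDpos : 0 < ‖(1 - x) * (1 - v * x) * (1 - v / (q : ℂ))‖ := lt_of_lt_of_le (by norm_num) hD
  -- numerator
  have hxq : ‖x‖ ≤ 2 / q := by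
    rw [norm_mul, Complex.norm_natCast] at hqx
    rw [le_div_iff₀ hq0]; linarith
  have hxmq : ‖x - 1 / (q : ℂ)‖ = ‖1 - (q : ℂ) * x‖ / q := by
    have : x - 1 / (q : ℂ) = -((1 - (q : ℂ) * x) / q) := by field_simp; ring
    rw [this, norm_neg, norm_div, Complex.norm_natCast]
  have hN : ‖(1 - w) * x * (1 - v / q) + v * (x - 1 / q) * (1 - x)‖ ≤
      (3 * ‖w - 1‖ + 8 / 5 * ‖1 - q * x‖) / q := by
    have t1 : ‖(1 - w) * x * (1 - v / (q : ℂ))‖ ≤ ‖w - 1‖ * (2 / q) * (3 / 2) := by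
      rw [norm_mul, norm_mul, norm_sub_rev]
      gcongr
      calc ‖(1 : ℂ) - v / q‖ ≤ ‖(1 : ℂ)‖ + ‖v / (q : ℂ)‖ := norm_sub_le _ _
        _ ≤ 1 + 1 / 2 := by
            rw [norm_one, norm_div, Complex.norm_natCast]
            have : ‖v‖ / (q : ℝ) ≤ 1 / 2 := by rw [div_le_iff₀ hq0]; linarith
            linarith
        _ = 3 / 2 := by norm_num
    have t2 : ‖v * (x - 1 / q) * (1 - x)‖ ≤ 1 * (‖1 - (q : ℂ) * x‖ / q) * (8 / 5) := by
      rw [norm_mul, norm_mul, hxmq]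
      gcongr
      calc ‖1 - x‖ ≤ ‖(1 : ℂ)‖ + ‖x‖ := norm_sub_le _ _
        _ ≤ 1 + 3 / 5 := by rw [norm_one]; gcongr
        _ = 8 / 5 := by norm_num
    calc _ ≤ ‖(1 - w) * x * (1 - v / (q : ℂ))‖ + ‖v * (x - 1 / q) * (1 - x)‖ := norm_add_le _ _
      _ ≤ ‖w - 1‖ * (2 / q) * (3 / 2) + 1 * (‖1 - (q : ℂ) * x‖ / q) * (8 / 5) := add_le_add t1 t2
      _ = (3 * ‖w - 1‖ + 8 / 5 * ‖1 - q * x‖) / q := by field_simp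
  have hn0 : 0 ≤ (3 * ‖w - 1‖ + 8 / 5 * ‖1 - (q : ℂ) * x‖) / q := by positivity
  calc _ ≤ ((3 * ‖w - 1‖ + 8 / 5 * ‖1 - q * x‖) / q) / (2 / 25) :=
        div_le_div₀ hn0 hN (by norm_num) hD
    _ = (75 / 2 * ‖w - 1‖ + 20 * ‖1 - q * x‖) / q := by
        field_simp
        ring
    _ ≤ (38 * ‖w - 1‖ + 20 * ‖1 - q * x‖) / q := by
        gcongr
        · norm_num

end Generic


section GenericSeries

variable {v w x c lam : ℂ} {q : ℕ}

/-- `‖1 − wx‖ ≥ 2/5` for `‖w‖ ≤ 1`, `‖x‖ ≤ 3/5`. [cite: Zhang2022LandauSiegel, App. A p. 105] -/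
private theorem norm_one_sub_wx_ge (hw : ‖w‖ ≤ 1) (hx : ‖x‖ ≤ 3 / 5) : 2 / 5 ≤ ‖1 - w * x‖ := by
  have hwx : ‖w * x‖ ≤ 3 / 5 := by rw [norm_mul]; nlinarith [norm_nonneg w, norm_nonneg x]
  have := norm_sub_norm_le (1 : ℂ) (w * x); rw [norm_one] at this; linarith

/-- **u036-type estimate**: `‖λ·(c(w−1)x/(1−wx))‖ ≤ 20B_w/q` for `‖λ‖ ≤ 2`, `‖c‖ ≤ 2`, `‖w‖ ≤ 1`,
`‖x‖ ≤ 3/5`, `‖x‖ ≤ 2/q`, `‖w − 1‖ ≤ B_w`. [cite: Zhang2022LandauSiegel, App. A p. 105] -/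
theorem norm_lam_mul_locTerm_le (hlam : ‖lam‖ ≤ 2) (hc : ‖c‖ ≤ 2) (hw : ‖w‖ ≤ 1) (hx : ‖x‖ ≤ 3 / 5)
    (hq : 0 < q) (hxq : ‖x‖ ≤ 2 / q) {Bw : ℝ} (hBw : ‖w - 1‖ ≤ Bw) :
    ‖lam * (c * (w - 1) * x / (1 - w * x))‖ ≤ 20 * Bw / q := by
  have hq0 : (0 : ℝ) < q := by exact_mod_cast hq
  have hden := norm_one_sub_wx_ge hw hx
  have hBw0 : 0 ≤ Bw := le_trans (norm_nonneg _) hBw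
  rw [norm_mul, norm_div, norm_mul, norm_mul]
  calc ‖lam‖ * (‖c‖ * ‖w - 1‖ * ‖x‖ / ‖1 - w * x‖) ≤ 2 * (2 * Bw * (2 / q) / (2 / 5)) := by
        gcongr
      _ = 20 * Bw / q := by field_simp; ring

/-- The identity `1 − qx(1−x)/(1−wx) = ((1−qx)(1−x) − x(w−1))/(1−wx)`.
[cite: Zhang2022LandauSiegel, App. A p. 105] -/
private theorem one_sub_aux_eq (h : 1 - w * x ≠ 0) :
    (1 : ℂ) - (q : ℂ) * (x * (1 - x) / (1 - w * x)) =
      ((1 - (q : ℂ) * x) * (1 - x) - x * (w - 1)) / (1 - w * x) := by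
  have h' : 1 - x * w ≠ 0 := by rwa [mul_comm] at h
  field_simp
  ring

/-- **u035-type estimate**: with `S = c(w−1)x/(1−wx) − (vq/(q−1))·x(1−x)/(1−wx)`,
`‖λS + v/(q−1)‖ ≤ (41B_w + 8B_x + 26B_λ)/q` for `‖v‖ ≤ 1`, `‖w‖ ≤ 1`, `‖x‖ ≤ 3/5`, `‖x‖ ≤ 2/q`,
`‖c‖ ≤ 2`, `‖w−1‖ ≤ B_w ≤ 1`, `‖1−qx‖ ≤ B_x`, `‖λ−1‖ ≤ B_λ`, `q ≥ 2`: the main term `−χ(q)/(q−1)` comes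
from the `r = 1` term of the local series. [cite: Zhang2022LandauSiegel, App. A p. 105] -/
theorem norm_lam_mul_locSer_add_le (hv : ‖v‖ ≤ 1) (hw : ‖w‖ ≤ 1) (hx : ‖x‖ ≤ 3 / 5) (hq : 2 ≤ q)
    (hxq : ‖x‖ ≤ 2 / q) (hc : ‖c‖ ≤ 2) {Bw Bx Bl : ℝ} (hBw : ‖w - 1‖ ≤ Bw) (hBw1 : Bw ≤ 1)
    (hBx : ‖1 - (q : ℂ) * x‖ ≤ Bx) (hBl : ‖lam - 1‖ ≤ Bl) :
    ‖lam * (c * (w - 1) * x / (1 - w * x) - v * q / ((q : ℂ) - 1) * (x * (1 - x) / (1 - w * x))) +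
        v / ((q : ℂ) - 1)‖ ≤ (41 * Bw + 8 * Bx + 26 * Bl) / q := by
  have hq' : (2 : ℝ) ≤ q := by exact_mod_cast hq
  have hq0 : (0 : ℝ) < q := by linarith
  have hden := norm_one_sub_wx_ge hw hx
  have hden0 : 1 - w * x ≠ 0 := by
    intro h; rw [h, norm_zero] at hden; linarith
  have hBw0 : 0 ≤ Bw := le_trans (norm_nonneg _) hBw
  have hBx0 : 0 ≤ Bx := le_trans (norm_nonneg _) hBx
  have hBl0 : 0 ≤ Bl := le_trans (norm_nonneg _) hBl
  have hq1 : (q : ℝ) / 2 ≤ ‖(q : ℂ) - 1‖ := by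
    have h := norm_sub_norm_le (q : ℂ) 1
    rw [norm_one, Complex.norm_natCast] at h; linarith
  have hq1pos : 0 < ‖(q : ℂ) - 1‖ := by linarith
  have hvq1 : ‖v / ((q : ℂ) - 1)‖ ≤ 2 / q := by
    rw [norm_div]
    calc ‖v‖ / ‖(q : ℂ) - 1‖ ≤ 1 / ((q : ℝ) / 2) := by gcongr
      _ = 2 / q := by field_simp
  have hvqq1 : ‖v * q / ((q : ℂ) - 1)‖ ≤ 2 := by
    rw [norm_div, norm_mul, Complex.norm_natCast]
    calc ‖v‖ * q / ‖(q : ℂ) - 1‖ ≤ 1 * q / ((q : ℝ) / 2) := by gcongr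
      _ = 2 := by field_simp
  have h1x : ‖1 - x‖ ≤ 8 / 5 := by
    calc ‖1 - x‖ ≤ ‖(1 : ℂ)‖ + ‖x‖ := norm_sub_le _ _
      _ ≤ 1 + 3 / 5 := by rw [norm_one]; gcongr
      _ = 8 / 5 := by norm_num
  set T1 : ℂ := c * (w - 1) * x / (1 - w * x) with hT1
  set T2 : ℂ := x * (1 - x) / (1 - w * x) with hT2
  set S : ℂ := T1 - v * q / ((q : ℂ) - 1) * T2 with hS
  -- the pieces
  have nT1 : ‖T1‖ ≤ 10 * Bw / q := by
    rw [hT1, norm_div, norm_mul, norm_mul]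
    calc ‖c‖ * ‖w - 1‖ * ‖x‖ / ‖1 - w * x‖ ≤ 2 * Bw * (2 / q) / (2 / 5) := by gcongr
      _ = 10 * Bw / q := by field_simp; ring
  have nT2 : ‖T2‖ ≤ 4 * ‖x‖ := by
    rw [hT2, norm_div, norm_mul]
    calc ‖x‖ * ‖1 - x‖ / ‖1 - w * x‖ ≤ ‖x‖ * (8 / 5) / (2 / 5) := by gcongr
      _ = 4 * ‖x‖ := by field_simp; ring
  have nS : ‖S‖ ≤ 26 / q := by
    calc ‖S‖ ≤ ‖T1‖ + ‖v * q / ((q : ℂ) - 1) * T2‖ := norm_sub_le _ _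
      _ ≤ 10 * Bw / q + 2 * (4 * (2 / q)) := by
          rw [norm_mul]
          gcongr
          exact nT2.trans (by gcongr)
      _ = (10 * Bw + 16) / q := by ring
      _ ≤ 26 / q := by gcongr; linarith
  -- the key regrouping: `λS + v/(q−1) = (λ−1)S + (T1 + v/(q−1)·(1 − q·T2))`
  have key : lam * S + v / ((q : ℂ) - 1) =
      (lam - 1) * S + (T1 + v / ((q : ℂ) - 1) * (1 - (q : ℂ) * T2)) := by
    rw [hS]; ring
  have hmid : ‖(1 : ℂ) - (q : ℂ) * T2‖ ≤ 4 * Bx + 5 * Bw / q := by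
    rw [hT2, one_sub_aux_eq hden0, norm_div]
    calc ‖(1 - (q : ℂ) * x) * (1 - x) - x * (w - 1)‖ / ‖1 - w * x‖
        ≤ (Bx * (8 / 5) + (2 / q) * Bw) / (2 / 5) := by
          gcongr
          calc _ ≤ ‖(1 - (q : ℂ) * x) * (1 - x)‖ + ‖x * (w - 1)‖ := norm_sub_le _ _
            _ ≤ Bx * (8 / 5) + (2 / q) * Bw := by rw [norm_mul, norm_mul]; gcongr
      _ = 4 * Bx + 5 * Bw / q := by field_simp; ring
  rw [key]
  calc ‖(lam - 1) * S + (T1 + v / ((q : ℂ) - 1) * (1 - (q : ℂ) * T2))‖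
      ≤ ‖lam - 1‖ * ‖S‖ + (‖T1‖ + ‖v / ((q : ℂ) - 1)‖ * ‖(1 : ℂ) - (q : ℂ) * T2‖) := by
        refine (norm_add_le _ _).trans ?_
        rw [norm_mul]
        gcongr
        exact (norm_add_le _ _).trans (by rw [norm_mul])
    _ ≤ Bl * (26 / q) + (10 * Bw / q + 2 / q * (4 * Bx + 5 * Bw / q)) := by gcongr
    _ ≤ (41 * Bw + 8 * Bx + 26 * Bl) / q := by
        have h5 : 5 * Bw / q ≤ 5 * Bw / 2 := by gcongr
        rw [show Bl * (26 / q) + (10 * Bw / q + 2 / q * (4 * Bx + 5 * Bw / q)) =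
          (26 * Bl + 10 * Bw + 2 * (4 * Bx + 5 * Bw / q)) / q by field_simp; ring]
        exact div_le_div_of_nonneg_right (by nlinarith) hq0.le

end GenericSeries

end Literature.NumberTheory.LFunctions.Zhang2022.AppendixA
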